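import Summits.Ventures.CertifiedManyBodySolver.Downfold.EmeryFermiFillingBi2201Subs
import Summits.Ventures.CertifiedManyBodySolver.Downfold.EmeryFermiFillingLa214
import Summits.Ventures.CertifiedManyBodySolver.Downfold.EmeryBoxesKSlicesN
import HarnessLib

/-!
# Bi₂Sr₂CuO₆₊δ (box #61 Bi-2201, Morée 2022 source rows): the typed 3BE one-body box `emeryBoxBi2201M61MoreePPSrc` ⇒ a CERTIFIED window for the object-E Fermi-surface `t′/t` of the σ three-band
# model at the box's own hole count

Venture CertifiedManyBodySolver, cell `pub/hubbard-downfold` (stage S1, HUMAN RULINGS D-0096/D-0098), seat hubbard-downfold-mod-4 (technique B = band level);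
namespace `Summit.Ventures.CertifiedManyBodySolver.Downfold.Emery`. Everything PROVED; numerics decided by the kernel (`EmeryFermiFillingBi2201Subs`).
Same device as `EmeryFermiFillingLa214` / `EmeryFermiFillingHg1201` / `EmeryFermiFillingLSCO`.

THE STATEMENT (`emeryBoxBi2201M61MoreePPSrc_fsRatio_window`). For every parameter vector of `emeryBoxBi2201M61MoreePPSrc` (`EmeryBoxesKSlicesN`: the Bi-2201 companion's ONE-BODY rows with the DFT-level Δ_pd sub-range (source box of the Morée-PP U-slice), n_H ∈ [1.144, 1.176]: Δ_pd [1.76, 2.36] × t_pd [1.25, 1.47] × t_pp [0.62, 0.74] × t_pp′ [0.14, 0.17]; n_H ∈ [1.144, 1.176])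
and every Fermi energy ε with `abFilling(ε) = (2 − n_H)/2` (the σ-model antibonding band holds the box's own electrons):
**`t′/t = fsRatio(ε) ∈ [-0.3162, -0.2456]`** and **ε ∈ [1.36, 2.28]** (box units, eV above ε_d).

READING (certified): box #61's object-E row `t′/t (E) ∈ [−0.411, −0.310]` vs the σ-model window [-0.3162, -0.2456] — see the corollary below (disjoint ⇒ MODEL-FORM\nceiling; overlapping ⇒ consistency cut only by sub-box).

WHAT THIS IS NOT: not a statement that the material's parameters ARE in the box (SCREENING-GRADE provenance); the theorem certifies the REDUCTION STEP
of the σ d–p_x–p_y(+t_pp, t_pp′) model only; not the interaction (`U`) reduction; no phase sentence. Sources: [HybertsenSchluterChristensen1989, Eq. (1)];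
[AndersenEtAl1995, §6]; [PavariniEtAl2001, Eq. (1)].
-/

noncomputable section

namespace Summit.Ventures.CertifiedManyBodySolver.Downfold.Emery

open Real Set
open Summit.Ventures.CertifiedManyBodySolver.Downfold

/-- Per-spin antibonding filling from the box's hole count: `n_H ∈ [143/125, 147/125] ⇒ (2 − n_H)/2 ∈ [103/250, 107/250]`. [folklore] -/
theorem abFilling_rowBi2201_of_nHoles {nH f : ℝ} (h1 : (143 / 125 : ℝ) ≤ nH) (h2 : nH ≤ (147 / 125 : ℝ)) (hf : f = (2 - nH) / 2) :
    f ∈ Set.Icc (103 / 250 : ℝ) (107 / 250 : ℝ) := by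
  rw [hf]; constructor <;> linarith

/-- **Bi₂Sr₂CuO₆₊δ (box #61 Bi-2201, Morée 2022 source rows): 3BE box ⇒ object-E `t′/t` window (raw coordinates)** at per-spin filling ∈ [0.412, 0.428]:
`ε ∈ [1.36, 2.28]` and `t′/t ∈ [-0.3162, -0.2456]`. [folklore] -/
theorem bi2201Box_fsRatio_window {Δ tpd tpp c ε : ℝ} (hΔ : Δ ∈ Set.Icc (44 / 25 : ℝ) (59 / 25 : ℝ))
    (ha : tpd ∈ Set.Icc (5 / 4 : ℝ) (147 / 100 : ℝ)) (hb : tpp ∈ Set.Icc (31 / 50 : ℝ) (37 / 50 : ℝ))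
    (hc : c ∈ Set.Icc (7 / 50 : ℝ) (17 / 100 : ℝ))
    (hν : abFilling Δ tpd tpp c ε ∈ Set.Icc (103 / 250 : ℝ) (107 / 250 : ℝ)) :
    ε ∈ Set.Icc (34 / 25 : ℝ) (57 / 25 : ℝ) ∧ fsRatio Δ tpd tpp c ε ∈ Set.Icc (-(1581 / 5000 : ℝ)) (-(307 / 1250 : ℝ)) := by
  have hΔ' := hΔ
  constructor
  · clear hΔ
    rcases mem_Icc_split hΔ' (103 / 50 : ℝ) with hΔ' | hΔ'
    · rcases mem_Icc_split hΔ' (191 / 100 : ℝ) with hΔ' | hΔ'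
      · rcases mem_Icc_split ha (34 / 25 : ℝ) with ha' | ha'
        · have h := (bi2201Sub_0_0 hΔ' ha' hb hc hν).1
          exact ⟨le_trans (by norm_num) h.1, h.2.trans (by norm_num)⟩
        · have h := (bi2201Sub_0_1 hΔ' ha' hb hc hν).1
          exact ⟨le_trans (by norm_num) h.1, h.2.trans (by norm_num)⟩
      · rcases mem_Icc_split ha (34 / 25 : ℝ) with ha' | ha'
        · have h := (bi2201Sub_1_0 hΔ' ha' hb hc hν).1
          exact ⟨le_trans (by norm_num) h.1, h.2.trans (by norm_num)⟩
        · have h := (bi2201Sub_1_1 hΔ' ha' hb hc hν).1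
          exact ⟨le_trans (by norm_num) h.1, h.2.trans (by norm_num)⟩
    · rcases mem_Icc_split hΔ' (221 / 100 : ℝ) with hΔ' | hΔ'
      · rcases mem_Icc_split ha (34 / 25 : ℝ) with ha' | ha'
        · have h := (bi2201Sub_2_0 hΔ' ha' hb hc hν).1
          exact ⟨le_trans (by norm_num) h.1, h.2.trans (by norm_num)⟩
        · have h := (bi2201Sub_2_1 hΔ' ha' hb hc hν).1
          exact ⟨le_trans (by norm_num) h.1, h.2.trans (by norm_num)⟩
      · rcases mem_Icc_split ha (34 / 25 : ℝ) with ha' | ha'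
        · have h := (bi2201Sub_3_0 hΔ' ha' hb hc hν).1
          exact ⟨le_trans (by norm_num) h.1, h.2.trans (by norm_num)⟩
        · have h := (bi2201Sub_3_1 hΔ' ha' hb hc hν).1
          exact ⟨le_trans (by norm_num) h.1, h.2.trans (by norm_num)⟩
  · clear hΔ
    rcases mem_Icc_split hΔ' (103 / 50 : ℝ) with hΔ' | hΔ'
    · rcases mem_Icc_split hΔ' (191 / 100 : ℝ) with hΔ' | hΔ'
      · rcases mem_Icc_split ha (34 / 25 : ℝ) with ha' | ha'
        · have h := (bi2201Sub_0_0 hΔ' ha' hb hc hν).2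
          exact ⟨le_trans (by norm_num) h.1, h.2.trans (by norm_num)⟩
        · have h := (bi2201Sub_0_1 hΔ' ha' hb hc hν).2
          exact ⟨le_trans (by norm_num) h.1, h.2.trans (by norm_num)⟩
      · rcases mem_Icc_split ha (34 / 25 : ℝ) with ha' | ha'
        · have h := (bi2201Sub_1_0 hΔ' ha' hb hc hν).2
          exact ⟨le_trans (by norm_num) h.1, h.2.trans (by norm_num)⟩
        · have h := (bi2201Sub_1_1 hΔ' ha' hb hc hν).2
          exact ⟨le_trans (by norm_num) h.1, h.2.trans (by norm_num)⟩
    · rcases mem_Icc_split hΔ' (221 / 100 : ℝ) with hΔ' | hΔ'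
      · rcases mem_Icc_split ha (34 / 25 : ℝ) with ha' | ha'
        · have h := (bi2201Sub_2_0 hΔ' ha' hb hc hν).2
          exact ⟨le_trans (by norm_num) h.1, h.2.trans (by norm_num)⟩
        · have h := (bi2201Sub_2_1 hΔ' ha' hb hc hν).2
          exact ⟨le_trans (by norm_num) h.1, h.2.trans (by norm_num)⟩
      · rcases mem_Icc_split ha (34 / 25 : ℝ) with ha' | ha'
        · have h := (bi2201Sub_3_0 hΔ' ha' hb hc hν).2
          exact ⟨le_trans (by norm_num) h.1, h.2.trans (by norm_num)⟩
        · have h := (bi2201Sub_3_1 hΔ' ha' hb hc hν).2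
          exact ⟨le_trans (by norm_num) h.1, h.2.trans (by norm_num)⟩

/-- The five rows of `emeryBoxBi2201M61MoreePPSrc` this file reads. [folklore] -/
theorem emeryBoxBi2201M61MoreePPSrc_mem_rows {p : EmeryCoord → ℝ} (hp : emeryBoxBi2201M61MoreePPSrc.Mem p) :
    p .DeltaPd ∈ Set.Icc (44 / 25 : ℝ) (59 / 25 : ℝ) ∧ p .tpd ∈ Set.Icc (5 / 4 : ℝ) (147 / 100 : ℝ) ∧
      p .tpp ∈ Set.Icc (31 / 50 : ℝ) (37 / 50 : ℝ) ∧ p .tppP ∈ Set.Icc (7 / 50 : ℝ) (17 / 100 : ℝ) ∧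
      p .nHoles ∈ Set.Icc (143 / 125 : ℝ) (147 / 125 : ℝ) := by
  have hΔ := (Entry.mem_ofEnds_iff _ _ _ _ _).1 (hp .DeltaPd bi2201M61MoreePPEmery_DeltaKS rfl)
  have ha := (Entry.mem_ofEnds_iff _ _ _ _ _).1 (hp .tpd bi2201M61MoreePPEmery_tpd rfl)
  have hb := (Entry.mem_ofEnds_iff _ _ _ _ _).1 (hp .tpp bi2201M61MoreePPEmery_tpp rfl)
  have hc := (Entry.mem_ofEnds_iff _ _ _ _ _).1 (hp .tppP bi2201M61MoreePPEmery_tppP rfl)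
  have hn := (Entry.mem_ofEnds_iff _ _ _ _ _).1 (hp .nHoles bi2201M61MoreePPEmery_nH rfl)
  push_cast at hΔ ha hb hc hn
  exact ⟨⟨hΔ.1, hΔ.2⟩, ⟨ha.1, ha.2⟩, ⟨hb.1, hb.2⟩, ⟨hc.1, hc.2⟩, ⟨hn.1, hn.2⟩⟩

/-- **THE WORD ON THE TYPED BOX `emeryBoxBi2201M61MoreePPSrc`**: at every parameter vector and every Fermi energy at which the σ-model antibonding band holds the
box's own electron count, `ε ∈ [1.36, 2.28]` and the exact σ-model Fermi-surface `t′/t ∈ [-0.3162, -0.2456]`.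
[cite: HybertsenSchluterChristensen1989, Eq. (1) (three-band d–p model)] -/
theorem emeryBoxBi2201M61MoreePPSrc_fsRatio_window :
    HoldsOn (fun p : EmeryCoord → ℝ => ∀ ε : ℝ,
      abFilling (p .DeltaPd) (p .tpd) (p .tpp) (p .tppP) ε = (2 - p .nHoles) / 2 →
      ε ∈ Set.Icc (34 / 25 : ℝ) (57 / 25 : ℝ) ∧
      fsRatio (p .DeltaPd) (p .tpd) (p .tpp) (p .tppP) ε ∈ Set.Icc (-(1581 / 5000 : ℝ)) (-(307 / 1250 : ℝ))) emeryBoxBi2201M61MoreePPSrc := by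
  intro p hp ε hf
  obtain ⟨hΔ, ha, hb, hc, hn⟩ := emeryBoxBi2201M61MoreePPSrc_mem_rows hp
  exact bi2201Box_fsRatio_window hΔ ha hb hc (abFilling_rowBi2201_of_nHoles hn.1 hn.2 hf)

end Summit.Ventures.CertifiedManyBodySolver.Downfold.Emery
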